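import Literature.AlgebraicGeometry.Resolution.FormalBranchesSplitting
import Literature.AlgebraicGeometry.Resolution.FormalBranchesChart
import Literature.AlgebraicGeometry.Resolution.FormalBranchesJacobian
import Literature.AlgebraicGeometry.Resolution.SmoothCoordinates
import Literature.AlgebraicGeometry.Resolution.DerivationCompletion
import Literature.AlgebraicGeometry.Resolution.AdicCompletionRegular
import Literature.AlgebraicGeometry.Resolution.AdicNoetherian
import Mathlib.RingTheory.AdicCompletion.LocalRing
import HarnessLib

/-!
# Formal normal crossings at a smooth point are strict normal crossings in an étale
neighbourhood of the local ring

Topic: `Literature/AlgebraicGeometry/Resolution`. Fifth file (the local assembly) of the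
Artin-approximation-free proof that FORMAL normal crossings are étale-local normal crossings
(de Jong 1996, between 4.25 (i) and 4.28/2.4; the named fact `DeJong1996FormalNormalCrossings`
of `AlterationsNormalFormBlowup.lean`), after `FormalBranchesModel.lean`,
`FormalBranchesChart.lean`, `FormalBranchesSplitting.lean`, `FormalBranchesJacobian.lean`.
Everything here is PROVED; no named facts.

**Theorem** (`exists_etale_isSNCIdeal_of_formal`). Let `A` be a regular local ring of dimension
`d`, essentially of finite type and formally smooth over a perfect field `k` (the local ring of
a point of a smooth `k`-scheme), `1 ≤ r ≤ d`, and `I ⊆ A` an ideal with a ring isomorphism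
`e : Â ≅ k⟦X₁, …, X_d⟧` carrying `I·Â` to `(X₁ ⋯ X_r)` (the formal normal crossings condition
of de Jong 1996, 4.25 (i), as rendered in `DeJong1996.NormalFormPair`). Then there are an étale
`A`-algebra `R'` and a prime `P` of `R'` over `𝔪_A` with `A → κ(P)` onto such that `I·R'_P` has
local strict normal crossings data (`IsSNCIdeal`).

Proof (no Artin approximation, no excellence): with `x_j = e⁻¹(X_j)`, the cofactors
`m_j = ∏_{i<r, i≠j} xᵢ` generate the ideal of the double locus of `π = x₁ ⋯ x_r` in `Â`;

1. `exists_coord_adapted` — minimal generators `u₁, …, u_d` of `𝔪_A` with `uⱼ ≡ xⱼ (mod 𝔪_Â²)`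
   (`Â = A + 𝔪_Â²`, faithful flatness, Nakayama);
2. dual derivations `Dᵢ(uⱼ) = δᵢⱼ` of `A` over `k` (the tree's
   `exists_coordSystem_coord_eq_of_perfectField`, `SmoothCoordinates.lean` — this is where
   smoothness and perfectness enter), extended to `Â` (`adicDerivation`, from the tree's
   `derivationAdicCompletion`, Stacks 07PE);
3. a generator `g` of `I` with `g = v·π` in `Â` (a finitely generated ideal becoming principal in
   the faithfully flat regular `Â` is principal, tree `exists_eq_span_singleton_of_map_eq`);
4. the Jacobian ideal `𝔇 = (g, Dᵢ g)` and `s = Σ_{i<r} Dᵢ g` have `𝔇·Â ≡ (m_j)` and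
   `s ≡ Σ a_l m_l` modulo `(π)` with units `a_l` (`FormalBranchesJacobian.lean`);
5. the chart `C = (A/I)[𝔇̄/s̄]` is a finite `A`-algebra with `Â ⊗_A C ≅ Π_{j<r} Â/(xⱼ)`
   (`FormalBranchesChart.lean`: blow-up algebras commute with flat base change, and the chart of
   the formal model is the product of the branch rings, `FormalBranchesModel.lean`);
6. étale splitting of `C` and descent (`FormalBranchesSplitting.lean`, Stacks 00UL through
   Mathlib).

The scheme-level statement (`DeJong1996FormalNormalCrossings`) additionally needs the
spreading of the étale `A`-algebra `R'` to an étale neighbourhood of the point; see the sequel.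

## Sources

* A. J. de Jong, *Smoothness, semi-stability and alterations*, Publ. Math. IHÉS 83 (1996),
  2.4 (p. 55), 4.25 (i) (p. 75). [DeJong1996]
* The Stacks Project, Tag 07PE (derivations and completion), Tag 00UL. [StacksProject]
* E. Bierstone, D. Grigoriev, P. Milman, J. Włodarczyk, arXiv:1206.3090, §3.5 (dual
  derivations at smooth points). [BierstoneGrigorievMilmanWlodarczyk2011]
-/

noncomputable section

open IsLocalRing TensorProduct

namespace Literature.AlgebraicGeometry.Resolution

universe u

/-! ## The completion of a Noetherian local ring: approximation lemmas -/

section Completion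

variable {A : Type u} [CommRing A] [IsLocalRing A] [IsNoetherianRing A]

local notation "Â" => AdicCompletion (maximalIdeal A) A

/-- Every element of `Â` is congruent to an element of `A` modulo `𝔪_Â` (the residue fields
agree, Mathlib `AdicCompletion.residueField_map_bijective`). [folklore] -/
theorem exists_sub_algebraMap_mem_maximalIdeal_adicCompletion (y : Â) :
    ∃ a : A, y - algebraMap A Â a ∈ maximalIdeal Â := by
  obtain ⟨z, hz⟩ := (AdicCompletion.residueField_map_bijective A).2 (residue Â y)
  obtain ⟨a, rfl⟩ := residue_surjective z
  refine ⟨a, ?_⟩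
  rw [← residue_eq_zero_iff, map_sub, sub_eq_zero, ← hz, ResidueField.map_residue]

/-- Every element of `Â` is congruent to an element of `A` modulo `𝔪_Â²`. [folklore] -/
theorem exists_sub_algebraMap_mem_maximalIdeal_sq_adicCompletion (y : Â) :
    ∃ a : A, y - algebraMap A Â a ∈ maximalIdeal Â ^ 2 := by
  obtain ⟨a₀, ha₀⟩ := exists_sub_algebraMap_mem_maximalIdeal_adicCompletion y
  -- `𝔪_Â = 𝔪_A Â`: induction on the membership of `y - a₀` in the extended ideal
  have key : ∀ z ∈ (maximalIdeal A).map (algebraMap A Â),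
      ∃ a ∈ maximalIdeal A, z - algebraMap A Â a ∈ maximalIdeal Â ^ 2 := by
    intro z hz
    rw [Ideal.map, ← Ideal.submodule_span_eq] at hz
    induction hz using Submodule.span_induction with
    | mem z hz =>
      obtain ⟨t, ht, rfl⟩ := hz
      exact ⟨t, ht, by rw [sub_self]; exact Ideal.zero_mem _⟩
    | zero => exact ⟨0, Ideal.zero_mem _, by rw [map_zero, sub_zero]; exact Ideal.zero_mem _⟩
    | add z₁ z₂ _ _ h₁ h₂ =>
      obtain ⟨a₁, ha₁, h₁⟩ := h₁
      obtain ⟨a₂, ha₂, h₂⟩ := h₂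
      refine ⟨a₁ + a₂, Ideal.add_mem _ ha₁ ha₂, ?_⟩
      have : z₁ + z₂ - algebraMap A Â (a₁ + a₂) =
          (z₁ - algebraMap A Â a₁) + (z₂ - algebraMap A Â a₂) := by rw [map_add]; ring
      rw [this]
      exact Ideal.add_mem _ h₁ h₂
    | smul c z hz h =>
      obtain ⟨a, ha, h⟩ := h
      obtain ⟨b, hb⟩ := exists_sub_algebraMap_mem_maximalIdeal_adicCompletion c
      refine ⟨b * a, Ideal.mul_mem_left _ _ ha, ?_⟩
      have hzm : z ∈ maximalIdeal Â := by
        have : Submodule.span Â (⇑(algebraMap A Â) '' ↑(maximalIdeal A)) ≤ maximalIdeal Â := by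
          rw [Ideal.submodule_span_eq, ← Ideal.map, ← AdicCompletion.maximalIdeal_eq_map]
        exact this hz
      have : c • z - algebraMap A Â (b * a) =
          algebraMap A Â b * (z - algebraMap A Â a) + (c - algebraMap A Â b) * z := by
        rw [map_mul, smul_eq_mul]; ring
      rw [this]
      refine Ideal.add_mem _ (Ideal.mul_mem_left _ _ h) ?_
      rw [pow_two]
      exact Ideal.mul_mem_mul hb hzm
  have hmem : y - algebraMap A Â a₀ ∈ (maximalIdeal A).map (algebraMap A Â) := by
    rwa [← AdicCompletion.maximalIdeal_eq_map]
  obtain ⟨a, -, ha⟩ := key _ hmem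
  refine ⟨a₀ + a, ?_⟩
  have : y - algebraMap A Â (a₀ + a) = y - algebraMap A Â a₀ - algebraMap A Â a := by
    rw [map_add]; ring
  rwa [this]

/-- `A → Â` is faithfully flat. [folklore] -/
instance faithfullyFlat_adicCompletion : Module.FaithfullyFlat A Â :=
  Module.FaithfullyFlat.of_flat_of_isLocalHom

/-- `𝔪_Â² ∩ A = 𝔪_A²` (faithful flatness and `𝔪_Â = 𝔪_A Â`). [folklore] -/
theorem comap_maximalIdeal_sq_adicCompletion :
    (maximalIdeal Â ^ 2).comap (algebraMap A Â) = maximalIdeal A ^ 2 := by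
  rw [AdicCompletion.maximalIdeal_eq_map, ← Ideal.map_pow, Ideal.comap_map_eq_self_of_faithfullyFlat]


omit [IsLocalRing A] [IsNoetherianRing A] in
/-- On the ring `Â`, the scalar action of `Â` on the completion of the module `A` is
multiplication (componentwise both are multiplication in `A/𝔪ⁿ`). [folklore] -/
theorem adicCompletion_moduleSmul_eq_mul (I : Ideal A) (y z : AdicCompletion I A) :
    @HSMul.hSMul _ _ _ (@instHSMul _ _ (AdicCompletion.smul I (M := A))) y z = y * z := by
  refine AdicCompletion.ext fun n => ?_
  rw [AdicCompletion.smul_eval, AdicCompletion.val_mul]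
  obtain ⟨y', hy'⟩ := Ideal.Quotient.mk_surjective (y.val n)
  obtain ⟨z', hz'⟩ := Ideal.Quotient.mk_surjective (z.val n)
  rw [← hy', ← hz']
  rfl

/-- **Derivations of `A` extend to derivations of the ring `Â`** (Stacks 07PE (1); the tree's
module-valued `derivationAdicCompletion`, repackaged with values in the ring `Â`).
[cite: StacksProject, Tag 07PE (1)] -/
def adicDerivation (δ : Derivation ℤ A A) : Derivation ℤ Â Â where
  toFun := derivationAdicCompletion (maximalIdeal A) δ
  map_add' y z := map_add _ y z
  map_smul' c y := map_zsmul _ c y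
  map_one_eq_zero' := (derivationAdicCompletion (maximalIdeal A) δ).map_one_eq_zero
  leibniz' y z := by
    have h := (derivationAdicCompletion (maximalIdeal A) δ).leibniz y z
    rw [adicCompletion_moduleSmul_eq_mul, adicCompletion_moduleSmul_eq_mul] at h
    rw [smul_eq_mul, smul_eq_mul]
    exact h

omit [IsNoetherianRing A] in
/-- `δ^(ι a) = ι (δ a)`. [cite: StacksProject, Tag 07PE (1)] -/
theorem adicDerivation_algebraMap (δ : Derivation ℤ A A) (a : A) :
    adicDerivation δ (algebraMap A Â a) = algebraMap A Â (δ a) :=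
  derivationAdicCompletion_algebraMap (maximalIdeal A) δ a

end Completion

/-! ## The main theorem -/

section Main

variable {k : Type u} [Field k] [PerfectField k]
variable {A : Type u} [CommRing A] [IsRegularLocalRing A] [Algebra k A] [Algebra.EssFiniteType k A]
  [Algebra.FormallySmooth k A]

local notation "Â" => AdicCompletion (maximalIdeal A) A

/-- **Minimal generators of `𝔪_A` adapted to formal coordinates**: for `x₁, …, x_d` generating
`𝔪_Â` there are `u₁, …, u_d ∈ A` with `uⱼ ≡ xⱼ (mod 𝔪_Â²)`, and any such `u` generate `𝔪_A`
(faithful flatness and Nakayama). [folklore] -/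
theorem exists_coord_adapted {d : ℕ} (x : Fin d → Â)
    (hspan : Ideal.span (Set.range x) = maximalIdeal Â) :
    ∃ u : Fin d → A, (∀ j, algebraMap A Â (u j) - x j ∈ maximalIdeal Â ^ 2) ∧
      Ideal.span (Set.range u) = maximalIdeal A := by
  choose u hu using fun j => exists_sub_algebraMap_mem_maximalIdeal_sq_adicCompletion (x j)
  have hu' : ∀ j, algebraMap A Â (u j) - x j ∈ maximalIdeal Â ^ 2 := fun j => by
    rw [← neg_sub]; exact Submodule.neg_mem _ (hu j)
  have hx : ∀ j, x j ∈ maximalIdeal Â := fun j => hspan ▸ Ideal.subset_span ⟨j, rfl⟩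
  refine ⟨u, hu', le_antisymm ?_ ?_⟩
  · rw [Ideal.span_le]
    rintro _ ⟨j, rfl⟩
    have hmem : algebraMap A Â (u j) ∈ maximalIdeal Â := by
      have : algebraMap A Â (u j) = x j + (algebraMap A Â (u j) - x j) := by ring
      rw [this]
      exact Ideal.add_mem _ (hx j) (Ideal.pow_le_self two_ne_zero (hu' j))
    exact (map_mem_nonunits_iff (algebraMap A Â) (u j)).mp hmem
  · -- Nakayama: `𝔪 ≤ (u) + 𝔪²`
    have hle : maximalIdeal A ≤ Ideal.span (Set.range u) ⊔ maximalIdeal A • maximalIdeal A := by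
      intro t ht
      have htm : algebraMap A Â t ∈ Ideal.span (Set.range x) := by
        rw [hspan]; exact map_nonunit _ t ht
      obtain ⟨c, hc⟩ := Ideal.mem_span_range_iff_exists_fun.mp htm
      choose b hb using fun j => exists_sub_algebraMap_mem_maximalIdeal_adicCompletion (c j)
      have key : algebraMap A Â (t - ∑ j, b j * u j) ∈ maximalIdeal Â ^ 2 := by
        have : algebraMap A Â (t - ∑ j, b j * u j) =
            ∑ j, ((c j - algebraMap A Â (b j)) * x j -
              algebraMap A Â (b j) * (algebraMap A Â (u j) - x j)) := by
          rw [map_sub, ← hc, map_sum, ← Finset.sum_sub_distrib]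
          refine Finset.sum_congr rfl fun j _ => ?_
          rw [map_mul]; ring
        rw [this]
        refine Ideal.sum_mem _ fun j _ => Ideal.sub_mem _ ?_ (Ideal.mul_mem_left _ _ (hu' j))
        rw [pow_two]
        exact Ideal.mul_mem_mul (hb j) (hx j)
      rw [← Ideal.mem_comap, comap_maximalIdeal_sq_adicCompletion, pow_two] at key
      have ht' : t = ∑ j, b j * u j + (t - ∑ j, b j * u j) := by ring
      rw [ht']
      refine Ideal.add_mem _ (Ideal.mem_sup_left (Ideal.sum_mem _ fun j _ =>
        Ideal.mul_mem_left _ _ (Ideal.subset_span ⟨j, rfl⟩))) (Ideal.mem_sup_right ?_)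
      rwa [Ideal.smul_eq_mul]
    exact Submodule.le_of_le_smul_of_le_jacobson_bot (IsNoetherian.noetherian _)
      (IsLocalRing.maximalIdeal_le_jacobson _) hle

omit [PerfectField k] in
/-- A variable of `k⟦X⟧` is non-zero. [folklore] -/
theorem MvPowerSeries.X_ne_zero_of_field {d : ℕ} (i : Fin d) :
    (MvPowerSeries.X i : MvPowerSeries (Fin d) k) ≠ 0 := by
  classical
  intro h
  have := congrArg (MvPowerSeries.coeff (Finsupp.single i 1)) h
  rw [MvPowerSeries.coeff_index_single_self_X, map_zero] at this
  exact one_ne_zero this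

omit [PerfectField k] in
/-- A product of finitely many variables of `k⟦X⟧` is non-zero. [folklore] -/
theorem prod_X_ne_zero {d : ℕ} (s : Finset (Fin d)) :
    (∏ i ∈ s, MvPowerSeries.X i : MvPowerSeries (Fin d) k) ≠ 0 :=
  Finset.prod_ne_zero_iff.mpr fun i _ => MvPowerSeries.X_ne_zero_of_field i


/-- **Formal normal crossings at a smooth point are strict normal crossings in an étale
neighbourhood of the local ring.** Let `A` be a regular local ring of dimension `d`,
essentially of finite type and formally smooth over a perfect field `k` (the local ring of a
smooth point of a variety), `1 ≤ r ≤ d`, and `I ⊆ A` an ideal whose completion is, in suitable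
formal coordinates, the normal crossings equation: `e : Â ≅ k⟦X₁, …, X_d⟧` with
`e(I·Â) = (X₁ ⋯ X_r)`. Then there is an étale `A`-algebra `R'` and a prime `P` of `R'` over
`𝔪_A` with `A → κ(P)` onto such that `I·R'_P` has local strict normal crossings data. Assembly
of the Artin-approximation-free proof: adapted minimal generators `uⱼ ≡ xⱼ (mod 𝔪_Â²)` of
`𝔪_A` (`exists_coord_adapted`), dual derivations `Dᵢ(uⱼ) = δᵢⱼ` (BGMW §3.5 / Matsumura 30.6,
`exists_coordSystem_coord_eq_of_perfectField`) extended to `Â` (`adicDerivation`), the Jacobian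
ideal `𝔇 = (g, Dᵢ g)` of a generator `g` of `I` and the generic element `s = Σ_{i<r} Dᵢ g`
(`FormalBranchesJacobian.lean`), the chart `(A/I)[𝔇̄/s̄]` with its formal branch decomposition
(`FormalBranchesChart.lean`), and the étale splitting and descent
(`FormalBranchesSplitting.lean`). [cite: DeJong1996, 4.25 (i) and 2.4, pp. 75, 55] -/
theorem exists_etale_isSNCIdeal_of_formal {d r : ℕ} (hdimA : ringKrullDim A = d) (hr : 1 ≤ r)
    (hrd : r ≤ d) (I : Ideal A) (e : Â ≃+* MvPowerSeries (Fin d) k)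
    (he : (I.map (algebraMap A Â)).map e.toRingHom =
      Ideal.span {∏ i ∈ Finset.univ.filter (fun i : Fin d => (i : ℕ) < r), MvPowerSeries.X i}) :
    ∃ (R' : Type u) (_ : CommRing R') (_ : Algebra A R') (_ : Algebra.Etale A R') (P : Ideal R')
      (_ : P.IsPrime) (_ : P.LiesOver (maximalIdeal A)),
      Function.Surjective (algebraMap A P.ResidueField) ∧
        IsSNCIdeal (I.map (algebraMap A (Localization.AtPrime P))) := by
  classical
  /- the completion -/
  haveI : IsRegularLocalRing Â := isRegularLocalRing_adicCompletion A
  have happrox : ∀ y : Â, ∃ a : A, y - algebraMap A Â a ∈ maximalIdeal Â :=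
    exists_sub_algebraMap_mem_maximalIdeal_adicCompletion
  /- formal coordinates -/
  let x : Fin d → Â := fun i => e.symm (MvPowerSeries.X i)
  have hspan : Ideal.span (Set.range x) = maximalIdeal Â := by
    have h1 : Ideal.span (Set.range x) =
        (Ideal.span (Set.range (MvPowerSeries.X : Fin d → MvPowerSeries (Fin d) k))).map
          e.symm.toRingHom := by
      rw [Ideal.map_span, ← Set.range_comp]
      rfl
    rw [h1, ← maximalIdeal_mvPowerSeries_eq_span k (Fin d)]
    exact IsLocalRing.eq_maximalIdeal
      (Ideal.map_isMaximal_of_equiv e.symm (p := maximalIdeal (MvPowerSeries (Fin d) k)))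
  have hdim : ringKrullDim Â = d := by
    rw [ringKrullDim_eq_of_ringEquiv e, ringKrullDim_mvPowerSeries, Nat.card_eq_fintype_card,
      Fintype.card_fin]
  have hx : ∀ i, x i ∈ maximalIdeal Â := fun i => hspan ▸ Ideal.subset_span ⟨i, rfl⟩
  have hli := linearIndependent_toCotangent_of_span_eq_maximalIdeal hdim x hspan
  have hprod : branchProd x r =
      e.symm (∏ i ∈ Finset.univ.filter (fun i : Fin d => (i : ℕ) < r), MvPowerSeries.X i) := by
    rw [map_prod]
    rfl
  have hπ0 : branchProd x r ≠ 0 := by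
    rw [hprod, map_ne_zero_iff _ e.symm.injective]
    exact prod_X_ne_zero _
  have hI : I.map (algebraMap A Â) = Ideal.span {branchProd x r} := by
    have := congrArg (Ideal.map e.symm.toRingHom) he
    rw [Ideal.map_map, Ideal.map_span, Set.image_singleton] at this
    convert this using 2
    · ext y
      simp
    · rw [hprod]
      rfl
  /- the equation `g` of the divisor -/
  obtain ⟨g, -, hgspan⟩ := SNCLocalDescent.exists_eq_span_singleton_of_map_eq (B := Â) I hπ0 hI
  haveI : IsDomain Â := isDomain_of_isRegularLocalRing _
  obtain ⟨w, hw⟩ := Ideal.span_singleton_eq_span_singleton.mp hgspan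
  let v : (Â)ˣ := w⁻¹
  have hg : algebraMap A Â g = v * branchProd x r := by
    rw [← hw, mul_comm (algebraMap A Â g), ← mul_assoc, Units.inv_mul, one_mul]
  /- adapted coordinates and dual derivations -/
  obtain ⟨u, hu, huspan⟩ := exists_coord_adapted x hspan
  have hcard : Fintype.card (Fin d) = (maximalIdeal A).spanFinrank := by
    have h := IsRegularLocalRing.spanFinrank_maximalIdeal (R := A)
    rw [hdimA] at h
    rw [Fintype.card_fin]
    exact_mod_cast h.symm
  obtain ⟨cs, hcs⟩ := exists_coordSystem_coord_eq_of_perfectField (k := k) u huspan hcard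
  let D : Fin d → Derivation ℤ A A := fun i => (cs.deriv i).restrictScalars ℤ
  have hDu : ∀ i j, D i (u j) = if i = j then 1 else 0 := by
    intro i j
    change cs.deriv i (u j) = _
    rw [← hcs]
    split_ifs with h
    · subst h; exact cs.deriv_coord_self i
    · exact cs.deriv_coord_of_ne i j h
  let Dh : Fin d → Derivation ℤ Â Â := fun i => adicDerivation (D i)
  have hcompat : ∀ i a, algebraMap A Â (D i a) = Dh i (algebraMap A Â a) := fun i a =>
    (adicDerivation_algebraMap (D i) a).symm
  /- the Jacobian ideal and the generic element -/
  let 𝔇 : Ideal A := doubleLocusIdealAlg D g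
  let s : A := genericElement r D g
  let a : Fin d → Â := genericCoeff x r Dh v
  have h𝔇 := map_map_doubleLocusIdealAlg hcompat hDu hu hg
  have hs := mk_algebraMap_genericElement (r := r) hcompat hg
  have ha : ∀ j ∈ branchSet d r, IsUnit (a j) := fun j hj => isUnit_genericCoeff hcompat hDu hu hj
  /- the chart and its formal branch decomposition -/
  let Φ := doubleLocusChartEquiv I x r hx hli a ha hI 𝔇 s h𝔇 hs
  haveI := finite_doubleLocusChart I x r hx hli a ha hI 𝔇 s h𝔇 hs
  /- étale splitting and descent -/
  exact exists_etale_isSNCIdeal_of_branchDecomposition happrox x hspan hdim hr hrd Φ I hI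

end Main

end Literature.AlgebraicGeometry.Resolution

end
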